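/-
Copyright (c) 2026. All rights reserved.
Released under Apache 2.0 license as described in the file LICENSE.
Authors: abc-iut cell, seat abc-iut-L4-t14 (gen 2; GAP row G-w5d226-1, file 2: the RC-holomorphic
widening of the holomorphic geometric model of `ArchimedeanHolFieldFunctorGeometric.lean`).
-/
import Literature.AnabelianGeometry.AbsoluteAnabelian.ArchimedeanHolFieldFunctorGeometric
import Literature.AnabelianGeometry.AbsoluteAnabelian.RCHolomorphicCalculus
import Literature.AnabelianGeometry.AbsoluteAnabelian.RCHolomorphicOpensTransfer
import Mathlib.Analysis.Complex.Basic
import Mathlib.Algebra.Star.Basic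
import HarnessLib

/-!
# [AbsTopIII] Def 4.1 (iii): the geometric `EA` with ALL RC-holomorphic finite étale morphisms
# (`𝒜_φ` = identity on holomorphic, complex conjugation on anti-holomorphic morphisms)

S. Mochizuki, *Topics in absolute anabelian geometry III*, Def 4.1 (i)/(iii) pp. 101–103, Cor 2.3 (i)
p. 53, Cor 2.7 (e) p. 60 (kurims manuscript `paper:url-5493eb38cbb7`, read on the page; bib key
`MochizukiAbsTopIII2015`).  PRINT: the morphisms of `EA ⊆ TH` are "the finite étale morphisms" of
Aut-holomorphic orbispaces (Def 4.1 (iii)), and a morphism of Aut-holomorphic spaces of Riemann surfaces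
is RC-HOLOMORPHIC — holomorphic or anti-holomorphic at each point (Cor 2.3 (i); abc-iut-L4-t2's
`IsRCHolomorphic`).  FILE 1 (`ArchimedeanHolFieldFunctorGeometric.lean`, `geometricAutHolFieldFunctor`)
is the HOLOMORPHIC SUB-MODEL (holomorphic finite étale maps only, `𝒜_φ = id`); THIS FILE 2 is the
PRINT-FAITHFUL WIDENING for Riemann surfaces:

* `HolRS.RCHom` / `HolRS.RC` / `HolRS.RC.category`: the same objects (connected Riemann surfaces) with
  morphisms the RC-holomorphic finite étale maps (`IsRCHolomorphic ∧ IsFiniteEtale`); composition by the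
  four parities hol∘hol = hol, anti∘anti = hol, hol∘anti = anti∘hol = anti, cited BY NAME from
  abc-iut-L4-t8's `RCHolomorphicCalculus` (`IsHolAt.comp`, `IsAntiHolAt.comp_isAntiHolAt`,
  `IsHolAt.comp_isAntiHolAt`, `IsAntiHolAt.comp_isHolAt`);
* THEOREMS: the type dichotomy `RCHom.isHol_or_isAntiHol` (a morphism with connected source is holomorphic
  everywhere or anti-holomorphic everywhere — abc-iut-w5-d053's
  `forall_isHolAt_or_forall_isAntiHolAt_of_injOn`, local injectivity from the covering map) and exclusivity
  `RCHom.not_isHolAt_and_isAntiHolAt`;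
* **`𝒜_φ := id` (holomorphic `φ`) / `:= complex conjugation` (anti-holomorphic `φ`)** — `RC.fieldIso`,
  FUNCTORIAL by the parity table (`RC.fieldIso_comp`; `conj ∘ conj = id`) — whence
  **`geometricAutHolFieldFunctorRC Q : AutHolFieldFunctor`** (abc-iut-L4-t10's interface) over the full
  subcategory cut out by an arbitrary object property `Q` (admissibility a PARAMETER).  Germ-level
  justification (abc-iut-w4-d104, BY NAME, not imported): along a holomorphic local isomorphism the
  multiplier of an `𝒜_p`-germ is preserved (`hasDerivAt_writtenInExtChartAt_conj_mulAffine`, p422636), along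
  an anti-holomorphic one it is conjugated (`hasDerivAt_antihol_conj_mulAffine`, p422168) — GAP-LEDGER
  D-G-w5d226-1;
* consistency with file 1 (`RC.fieldIso_of_mdifferentiable`: `𝒜 = id` on holomorphic maps) and
  NON-VACUITY of the new branch (`RC.exists_antihol_aut_complexPlane`: complex conjugation is an
  anti-holomorphic automorphism of the complex plane with `𝒜 = conj`).

MODELLING CHOICES (b)–(d) of file 1 are UNCHANGED: the ORBI case `[𝕌/Γ]`, `Γ ≠ 1`, is not constructed;
`𝒜_𝕏 := ℂ` is the multiplier field, bridged to the germ model by abc-iut-w4-d104's theorems; Cor 2.7's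
ALGORITHMS are NOT constructed (a MODEL, not a reconstruction); the hypothesis `IsIdRigid EA` of the
model theorems stays open (⇐ Lemma 4.3; campaign-L).  Choice (a) is closed for Riemann surfaces by this
file.  Refereed pre-IUT anabelian geometry; nothing here bears on [IUTchIII] Cor. 3.12 or takes a side;
typed ≠ discharged; model ≠ reconstruction.
-/

set_option autoImplicit false

noncomputable section

open scoped ComplexConjugate

namespace Literature.AnabelianGeometry.AbsoluteAnabelian

open _root_.CategoryTheory _root_.Topology _root_.TopologicalSpace _root_.Set
open scoped _root_.Manifold _root_.ContDiff

namespace HolRS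

/-! ### RC-holomorphic finite étale maps -/

/-- **An RC-holomorphic finite étale map** of connected Riemann surfaces (abc-iut-L4-t2's
`IsRCHolomorphic` — the conclusion of Cor 2.3 (i) — and `IsFiniteEtale`): "the finite étale morphisms"
of `TH` between Riemann surfaces (Def 4.1 (iii)). [cite: MochizukiAbsTopIII2015, Definition 4.1 (iii) p.103] -/
@[ext]
structure RCHom (X Y : HolRS) : Type 1 where
  /-- the underlying map -/
  toFun : X.carrier → Y.carrier
  /-- holomorphic or anti-holomorphic at each point -/
  isRCHolomorphic : IsRCHolomorphic toFun
  /-- finite étale (covering map with finite fibres) -/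
  isFiniteEtale : IsFiniteEtale toFun

namespace RCHom

variable {X Y Z : HolRS}

/-- An RC-holomorphic finite étale map is continuous. [cite: MochizukiAbsTopIII2015, Definition 2.1 (ii) p.51] -/
theorem continuous (f : RCHom X Y) : Continuous f.toFun := f.isFiniteEtale.isCoveringMap.continuous

/-- … and injective on an open neighbourhood of every point. [cite: MochizukiAbsTopIII2015, Definition 2.1 (ii) p.51] -/
theorem exists_injOn_nhds (f : RCHom X Y) (p : X.carrier) :
    ∃ N : Set X.carrier, IsOpen N ∧ p ∈ N ∧ InjOn f.toFun N := by
  obtain ⟨e, hpe, hfe⟩ := f.isFiniteEtale.isCoveringMap.isLocalHomeomorph p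
  exact ⟨e.source, e.open_source, hpe, by rw [hfe]; exact e.injOn⟩

/-- **Holomorphic and anti-holomorphic points exclude each other.**
[cite: MochizukiAbsTopIII2015, Definition 2.1 (ii) p.51] -/
theorem not_isHolAt_and_isAntiHolAt (f : RCHom X Y) (p : X.carrier) :
    ¬ (IsHolAt f.toFun p ∧ IsAntiHolAt f.toFun p) := by
  obtain ⟨N, hN, hpN, hinj⟩ := f.exists_injOn_nhds p
  exact not_isHolAt_and_isAntiHolAt_of_injOn f.continuous hN hpN hinj

/-- **The type of a morphism is constant** (connected source): holomorphic at every point or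
anti-holomorphic at every point. [cite: MochizukiAbsTopIII2015, Corollary 2.3 (i) p.53] -/
theorem isHol_or_isAntiHol (f : RCHom X Y) :
    (∀ p, IsHolAt f.toFun p) ∨ ∀ p, IsAntiHolAt f.toFun p := by
  rcases forall_isHolAt_or_forall_isAntiHolAt_of_injOn f.continuous isOpen_univ isPreconnected_univ
      (fun p _ => f.exists_injOn_nhds p) (fun p _ => f.isRCHolomorphic p) with h | h
  · exact Or.inl fun p => h p (mem_univ p)
  · exact Or.inr fun p => h p (mem_univ p)

/-- A morphism anti-holomorphic at every point is not holomorphic at every point (the source is nonempty).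
[cite: MochizukiAbsTopIII2015, Definition 2.1 (ii) p.51] -/
theorem not_isHol_of_forall_isAntiHolAt {f : RCHom X Y} (h : ∀ p, IsAntiHolAt f.toFun p) :
    ¬ ∀ p, IsHolAt f.toFun p := by
  intro hh
  obtain ⟨p⟩ := (inferInstance : Nonempty X.carrier)
  exact f.not_isHolAt_and_isAntiHolAt p ⟨hh p, h p⟩

/-- The identity. [cite: MochizukiAbsTopIII2015, Remark 2.3.3 p.54] -/
protected def id (X : HolRS) : RCHom X X where
  toFun := _root_.id
  isRCHolomorphic := fun _ => Or.inl (Filter.Eventually.of_forall fun _ => mdifferentiableAt_id)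
  isFiniteEtale := IsFiniteEtale.id

/-- Composition: RC-holomorphic by the four parities, finite étale by `IsFiniteEtale.comp`.
[cite: MochizukiAbsTopIII2015, Remark 2.3.3 p.54] -/
protected def comp (f : RCHom X Y) (g : RCHom Y Z) : RCHom X Z where
  toFun := g.toFun ∘ f.toFun
  isRCHolomorphic := fun x => by
    rcases f.isRCHolomorphic x with hf | hf <;> rcases g.isRCHolomorphic (f.toFun x) with hg | hg
    · exact Or.inl (hg.comp hf)
    · exact Or.inr (hg.comp_isHolAt hf)
    · exact Or.inr (hg.comp_isAntiHolAt hf)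
    · exact Or.inl (hg.comp_isAntiHolAt hf)
  isFiniteEtale := g.isFiniteEtale.comp f.isFiniteEtale

/-- The identity is holomorphic. [cite: MochizukiAbsTopIII2015, Definition 2.1 (ii) p.51] -/
theorem isHol_id (X : HolRS) : ∀ p, IsHolAt (RCHom.id X).toFun p := fun _ =>
  Filter.Eventually.of_forall fun _ => mdifferentiableAt_id

end RCHom

/-- Connected Riemann surfaces, to carry the RC-holomorphic finite étale maps as morphisms (a wrapper
around `HolRS`). [cite: MochizukiAbsTopIII2015, Definition 4.1 (iii) p.103] -/
structure RC : Type 1 where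
  /-- the underlying connected Riemann surface -/
  of : HolRS

namespace RC

/-- `TH` restricted to Riemann surfaces: **connected Riemann surfaces with RC-holomorphic finite étale
maps form a category**. [cite: MochizukiAbsTopIII2015, Definition 4.1 (iii) p.103] -/
instance category : Category.{1} RC where
  Hom X Y := RCHom X.of Y.of
  id X := RCHom.id X.of
  comp f g := RCHom.comp f g
  id_comp _ := rfl
  comp_id _ := rfl
  assoc _ _ _ := rfl

variable {X Y Z : RC}

/-- Two morphisms with the same underlying map are equal. [cite: MochizukiAbsTopIII2015, Definition 4.1 (iii) p.103] -/
theorem hom_ext {f g : X ⟶ Y} (h : f.toFun = g.toFun) : f = g := RCHom.ext h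

/-! ### `𝒜_φ`: identity on holomorphic, complex conjugation on anti-holomorphic morphisms -/

/-- `conj ∘ conj = id` on `ℂ`, for Mathlib's ring automorphism `starRingAut` (= complex conjugation).
[cite: MochizukiAbsTopIII2015, Corollary 2.7 (e) p.60] -/
theorem starRingAut_trans_starRingAut :
    (starRingAut : ℂ ≃+* ℂ).trans starRingAut = RingEquiv.refl ℂ :=
  RingEquiv.ext fun z => Complex.conj_conj z

open Classical in
/-- **`𝒜_φ`**: the isomorphism `𝒜_𝕏 ⥲ 𝒜_𝕐` of the multiplier field `ℂ` induced by `φ` — the identity when `φ`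
is holomorphic, complex conjugation (`starRingAut`) when `φ` is anti-holomorphic (transport of
multipliers, GAP-LEDGER D-G-w5d226-1). [cite: MochizukiAbsTopIII2015, Definition 4.1 (i) p.101] -/
def fieldIso (f : X ⟶ Y) : ℂ ≃+* ℂ :=
  if ∀ p, IsHolAt f.toFun p then RingEquiv.refl ℂ else starRingAut

/-- `𝒜_φ = id` for holomorphic `φ`. [cite: MochizukiAbsTopIII2015, Definition 4.1 (i) p.101] -/
theorem fieldIso_of_isHol {f : X ⟶ Y} (h : ∀ p, IsHolAt f.toFun p) : fieldIso f = RingEquiv.refl ℂ := by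
  simp [fieldIso, h]

/-- `𝒜_φ = conj` for anti-holomorphic `φ`. [cite: MochizukiAbsTopIII2015, Definition 4.1 (i) p.101] -/
theorem fieldIso_of_forall_isAntiHolAt {f : X ⟶ Y} (h : ∀ p, IsAntiHolAt f.toFun p) :
    fieldIso f = starRingAut := by
  simp [fieldIso, RCHom.not_isHol_of_forall_isAntiHolAt h]

/-- `𝒜_{id} = id`. [cite: MochizukiAbsTopIII2015, Definition 4.1 (i) p.101] -/
theorem fieldIso_id (X : RC) : fieldIso (𝟙 X) = RingEquiv.refl ℂ := fieldIso_of_isHol (RCHom.isHol_id X.of)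
/-- **Functoriality `𝒜_{φ ≫ ψ} = 𝒜_φ ≫ 𝒜_ψ`** by the parity table: hol∘hol = hol, anti∘anti = hol,
hol∘anti = anti∘hol = anti, and `conj ∘ conj = id`. [cite: MochizukiAbsTopIII2015, Definition 4.1 (i) p.101] -/
theorem fieldIso_comp (f : X ⟶ Y) (g : Y ⟶ Z) : fieldIso (f ≫ g) = (fieldIso f).trans (fieldIso g) := by
  rcases RCHom.isHol_or_isAntiHol f with hf | hf <;> rcases RCHom.isHol_or_isAntiHol g with hg | hg
  · rw [fieldIso_of_isHol hf, fieldIso_of_isHol hg,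
      fieldIso_of_isHol (fun p => (hg (f.toFun p)).comp (hf p))]
    rfl
  · rw [fieldIso_of_isHol hf, fieldIso_of_forall_isAntiHolAt hg,
      fieldIso_of_forall_isAntiHolAt (fun p => (hg (f.toFun p)).comp_isHolAt (hf p))]
    rfl
  · rw [fieldIso_of_forall_isAntiHolAt hf, fieldIso_of_isHol hg,
      fieldIso_of_forall_isAntiHolAt (fun p => (hg (f.toFun p)).comp_isAntiHolAt (hf p))]
    rfl
  · rw [fieldIso_of_forall_isAntiHolAt hf, fieldIso_of_forall_isAntiHolAt hg,
      fieldIso_of_isHol (fun p => (hg (f.toFun p)).comp_isAntiHolAt (hf p)), starRingAut_trans_starRingAut]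

/-- `𝒜_φ` is continuous (identity or conjugation). [cite: MochizukiAbsTopIII2015, Definition 4.1 (i) p.101] -/
theorem continuous_fieldIso (f : X ⟶ Y) : Continuous (fieldIso f) := by
  unfold fieldIso; split_ifs; exacts [continuous_id, Complex.continuous_conj]

/-- … with continuous inverse. [cite: MochizukiAbsTopIII2015, Definition 4.1 (i) p.101] -/
theorem continuous_fieldIso_symm (f : X ⟶ Y) : Continuous (fieldIso f).symm := by
  unfold fieldIso; split_ifs; exacts [continuous_id, Complex.continuous_conj]

end RC

/-! ### The RC-holomorphic geometric instance of `AutHolFieldFunctor` -/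

/-- **Def 4.1 (i)/(iii) + Cor 2.7 (e) at the RC-holomorphic geometric model**: `EA :=` the full
subcategory of `HolRS.RC` (connected Riemann surfaces, RC-holomorphic finite étale maps) cut out by the
object property `Q` (admissibility a parameter), `𝒜_𝕏 := ℂ` (multiplier field), `𝒜_φ := id / conj`
according to the type of `φ`, functorially. [cite: MochizukiAbsTopIII2015, Definition 4.1 (i) p.101] -/
def geometricAutHolFieldFunctorRC (Q : ObjectProperty RC) : AutHolFieldFunctor.{0} where
  EA := Q.FullSubcategory
  cat := inferInstance
  A := fun _ => ℂ
  isCAF := fun _ => isCAF_complex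
  Amap := fun {X Y : Q.FullSubcategory} (f : X ⟶ Y) => RC.fieldIso f.hom
  continuous_Amap := fun {X Y : Q.FullSubcategory} (f : X ⟶ Y) => RC.continuous_fieldIso f.hom
  continuous_Amap_symm := fun {X Y : Q.FullSubcategory} (f : X ⟶ Y) => RC.continuous_fieldIso_symm f.hom
  Amap_id := fun X : Q.FullSubcategory => RC.fieldIso_id X.obj
  Amap_comp := fun {X Y Z : Q.FullSubcategory} (f : X ⟶ Y) (g : Y ⟶ Z) => RC.fieldIso_comp f.hom g.hom

/-- `EA` of the RC instance is nonempty as soon as `Q` admits an object.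
[cite: MochizukiAbsTopIII2015, Definition 4.1 (iii) p.103] -/
theorem nonempty_EA_RC (Q : ObjectProperty RC) (X : RC) (hX : Q X) :
    Nonempty (geometricAutHolFieldFunctorRC Q).EA := ⟨(⟨X, hX⟩ : Q.FullSubcategory)⟩

/-- **Cor 4.5 at the archimedean model over the RC-holomorphic geometric `EA`** (abc-iut-L4-t10's
`cor_4_5_arch`), modulo one object and `IsIdRigid EA` (⇐ Lemma 4.3; not proved). [cite: MochizukiAbsTopIII2015, Corollary 4.5 pp.107–109] -/
theorem cor_4_5_geometricRC (Q : ObjectProperty RC) (X₀ : (geometricAutHolFieldFunctorRC Q).EA)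
    (hE : IsIdRigid (geometricAutHolFieldFunctorRC Q).EA) :
    Literature.AnabelianGeometry.AbsoluteAnabelian.AbsTopIII.Cor_4_5
      (archLogFrobeniusData (geometricAutHolFieldFunctorRC Q))
      (archTelecoreData (geometricAutHolFieldFunctorRC Q)) :=
  AbsTopIII.cor_4_5_arch (geometricAutHolFieldFunctorRC Q) X₀ hE

/-! ### Consistency with file 1; the anti-holomorphic branch is inhabited -/

/-- **Consistency with the holomorphic sub-model**: on a HOLOMORPHIC finite étale map (a morphism of
file 1's `HolRS`, read in `HolRS.RC`) `𝒜_φ` is the identity, as in `geometricAutHolFieldFunctor`.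
[cite: MochizukiAbsTopIII2015, Definition 4.1 (i) p.101] -/
theorem RC.fieldIso_of_mdifferentiable {X Y : RC} (f : X ⟶ Y)
    (hf : MDifferentiable 𝓘(ℂ, ℂ) 𝓘(ℂ, ℂ) f.toFun) : RC.fieldIso f = RingEquiv.refl ℂ :=
  RC.fieldIso_of_isHol fun _ => Filter.Eventually.of_forall fun y => hf y

/-- Every morphism of file 1's holomorphic category is a morphism of `HolRS.RC` with `𝒜 = id`.
[cite: MochizukiAbsTopIII2015, Definition 4.1 (iii) p.103] -/
theorem RC.exists_of_hom {X Y : HolRS} (f : X ⟶ Y) :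
    ∃ g : (⟨X⟩ : RC) ⟶ ⟨Y⟩, g.toFun = f.toFun ∧ RC.fieldIso g = RingEquiv.refl ℂ :=
  ⟨⟨f.toFun, fun x => Or.inl (Hom.isHolAt f x), f.isFiniteEtale⟩, rfl,
    RC.fieldIso_of_mdifferentiable _ f.mdifferentiable⟩

/-- Complex conjugation is ANTI-holomorphic at every point of the complex plane.
[cite: MochizukiAbsTopIII2015, Definition 2.1 (ii) p.51] -/
theorem isAntiHolAt_conj (z : ℂ) : IsAntiHolAt (fun w : ℂ => conj w) z := by
  refine Filter.Eventually.of_forall fun y => ⟨Complex.continuous_conj.continuousAt, ?_⟩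
  have h : (starRingEnd ℂ ∘ writtenInExtChartAt 𝓘(ℂ, ℂ) 𝓘(ℂ, ℂ) y fun w : ℂ => conj w) = id := by
    funext w
    simp [writtenInExtChartAt]
  rw [h]
  exact differentiableAt_id

/-- **The anti-holomorphic branch is inhabited, with `𝒜 = conj`**: complex conjugation is an
RC-holomorphic finite étale automorphism of the complex plane (an automorphism of its Aut-holomorphic
space, Cor 2.3 (i)) which is NOT holomorphic, and along it the induced isomorphism of the multiplier field
is complex conjugation. [cite: MochizukiAbsTopIII2015, Corollary 2.3 (i) p.53] -/
theorem RC.exists_antihol_aut_complexPlane :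
    ∃ φ : (⟨complexPlane⟩ : RC) ≅ ⟨complexPlane⟩,
      (¬ ∀ p, IsHolAt φ.hom.toFun p) ∧ RC.fieldIso φ.hom = starRingAut := by
  let c : (⟨complexPlane⟩ : RC) ⟶ ⟨complexPlane⟩ :=
    ⟨fun w : ℂ => (starRingEnd ℂ w : ℂ), fun z => Or.inr (isAntiHolAt_conj z),
      IsFiniteEtale.of_homeomorph Complex.conjCLE.toHomeomorph⟩
  have hcc : c ≫ c = 𝟙 _ :=
    RC.hom_ext (funext fun z : ℂ => (Complex.conj_conj z : starRingEnd ℂ (starRingEnd ℂ z) = z))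
  have hanti : ∀ z, IsAntiHolAt c.toFun z := fun z => isAntiHolAt_conj z
  exact ⟨⟨c, c, hcc, hcc⟩, RCHom.not_isHol_of_forall_isAntiHolAt hanti,
    RC.fieldIso_of_forall_isAntiHolAt hanti⟩

end HolRS

end Literature.AnabelianGeometry.AbsoluteAnabelian

end
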